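import Summits.Ventures.QEC.CircuitDistance.PortK2DataBB144Z
import Summits.Ventures.QEC.CircuitDistance.K2Chunks
import HarnessLib

/-!
# K2(`[[144,12,12]]`) chunk module `K2C144Z4` — COMPUTATIONAL (native_decide; `Lean.ofReduceBool`)

Cell `qec`, CDX, R146 STEP 1 («computational» header; `ofReduceBool` confined to these chunk modules). Checker of record
`K2.K2Data` (qec-cdx-type-1, PortK2Check); data module of record `PortK2DataBB144X/Z` (p669158/9, crit-1 data audit PASS
2026-08-28T21:20Z); chunk glue `K2Chunks` (idea-1 g2). cube 4, depth-1 chunks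
Leaf theorems: the K2 DFS accepts below one child / grandchild state of a pivot cube; assemblies re-derive the child lists in the
kernel (`decide`) and end in the literal cube fact `d144S.cube (Ts144S.getD k []) (72*k) (lives144S.getD k 0) = true` (the `hcubes`
hypothesis of `K2Inst.k2_complete`). Emitted by qec-cdx-eng-1 with idea-1's `gen_k2chunks_from_lean.py`.
-/

namespace Summit.Ventures.QEC.CircuitDistance.K2

set_option maxRecDepth 100000 in
set_option maxHeartbeats 0 in
set_option exponentiation.threshold 1024 in
/-- K2(144) chunk fact `cube144Z4_ch0` (see the module docstring). -/
theorem cube144Z4_ch0 : app5 (d144Z.dfs (Ts144Z.getD 4 []) 7) (2527206194296068769792, 385, 255126820278220547425711093299319090971534005359039379046958020146190821967429621648457728, 2, 2348542582773833227633856453274706693307816073360853958895656510022372298350209959340615016920326548007944192) = true := by native_decide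
set_option maxRecDepth 100000 in
set_option maxHeartbeats 0 in
set_option exponentiation.threshold 1024 in
/-- K2(144) chunk fact `cube144Z4_ch1` (see the module docstring). -/
theorem cube144Z4_ch1 : app5 (d144Z.dfs (Ts144Z.getD 4 []) 7) (2379918220282730385920, 3811, 32593072944588187166937286396798197397663594754805777357895687653646993955710399832309891072, 2, 2348542582773833195041280831922929313012685058810803382072162211367392288171962769670514220706939249073586176) = true := by native_decide
set_option maxRecDepth 100000 in
set_option maxHeartbeats 0 in
set_option exponentiation.threshold 1024 in
/-- K2(144) chunk fact `cube144Z4_ch2` (see the module docstring). -/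
theorem cube144Z4_ch2 : app5 (d144Z.dfs (Ts144Z.getD 4 []) 7) (2379629989923792355328, 133, 2135987036418233318804808348324934362749525362457108920744389325262683702673800047035495462469632, 2, 2348542582771697208005359921840534291306515506696200677549805558597445246564140549944733580156916286986649600) = true := by native_decide
set_option maxRecDepth 100000 in
set_option maxHeartbeats 0 in
set_option exponentiation.threshold 1024 in
/-- Cube 4 passes — assembled from its 3 depth-1 chunks (glue `K2Data.cube_of_children`). -/
theorem cube144Z4_chunked : d144Z.cube (Ts144Z.getD 4 []) 288 (lives144Z.getD 4 0) = true :=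
  d144Z.cube_of_children (Ts144Z.getD 4 []) 288 (lives144Z.getD 4 0) 7
    [(2527206194296068769792, 385, 255126820278220547425711093299319090971534005359039379046958020146190821967429621648457728, 2, 2348542582773833227633856453274706693307816073360853958895656510022372298350209959340615016920326548007944192), (2379918220282730385920, 3811, 32593072944588187166937286396798197397663594754805777357895687653646993955710399832309891072, 2, 2348542582773833195041280831922929313012685058810803382072162211367392288171962769670514220706939249073586176), (2379629989923792355328, 133, 2135987036418233318804808348324934362749525362457108920744389325262683702673800047035495462469632, 2, 2348542582771697208005359921840534291306515506696200677549805558597445246564140549944733580156916286986649600)]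
    (by decide) (by decide) (by decide) (by decide)
    (all_cons_of cube144Z4_ch0 (all_cons_of cube144Z4_ch1 (all_cons_of cube144Z4_ch2 (all_nil_of _))))

end Summit.Ventures.QEC.CircuitDistance.K2
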